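import Mathlib
import Summits.MatrixMultiplication.MatrixMultiplication.Theses.FieldSumsetRank
import Summits.MatrixMultiplication.MatrixMultiplication.Theorems.FieldSumsetRankTwoByTwoHostingEightRigidity
import Literature.Combinatorics.Additive.LinearVosperProofs
import Literature.Combinatorics.Additive.LinearCauchyDavenportProofs

/-!
# `TwoByTwoHostingEight`: every polynomial hosting of `⟨2,2,2⟩` costs at least `8`

Route FieldSumsetRank, item stmt-MatrixMultiplication-8741. A polynomial hosting of `2 × 2` matrix
multiplication is a triple of `ℂ`-linear maps `α, β : M₂(ℂ) → ℂ[t]`, `γ : ℂ[t] → M₂(ℂ)` with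
`γ(α(X) β(Y)) = XY`; its cost is `dim(V₁V₂)`, `V₁ = range α`, `V₂ = range β`. We prove
`dim(V₁V₂) ≥ 8`.

Proof. `α, β` are injective (`X = γ(α(X)β(1))`), so `dim V₁ = dim V₂ = 4`; inside `ℂ(t)` the
linear Cauchy–Davenport inequality (`Literature.Combinatorics.Additive.LinearCauchyDavenport_holds`,
the base `ℂ` being algebraically closed in `ℂ(t)`) gives `dim V₁V₂ ≥ 7`. If `dim V₁V₂ = 7`, the
linear Vosper theorem (`LinearVosperAlgClosed_holds`, Bachoc–Serra–Zémor Thm 34) makes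
`V₁ = g⟨1,a,a²,a³⟩`, `V₂ = g'⟨1,a,a²,a³⟩` with `a ∉ ℂ`; `γ` maps the `7`-dimensional `V₁V₂` onto
`M₂(ℂ)`, so the products `α(X)β(Y)` with `XY = 0` span at most `3` dimensions, and after dividing
by `g, g'` this contradicts the rigidity theorem
`Summit.MatrixMultiplication.MatrixMultiplication.Theorems.TwoByTwoHosting.rigidity`.
-/

set_option linter.dupNamespace false

noncomputable section

open Module Polynomial

namespace Summit.MatrixMultiplication.MatrixMultiplication.Theorems

namespace TwoByTwoHosting

open Literature.Combinatorics.Additive Literature.Combinatorics.Additive.BachocSerraZemor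

/-- `ℂ(t)` has no constants other than `ℂ`: `X ∉ ℂ`. -/
theorem algebraMap_ne_ratFunc_X (c : ℂ) : algebraMap ℂ (RatFunc ℂ) c ≠ RatFunc.X := by
  intro h
  have := congrArg RatFunc.intDegree h
  rw [RatFunc.algebraMap_eq_C, RatFunc.intDegree_C, RatFunc.intDegree_X] at this
  exact zero_ne_one this

/-- `ℂ` is algebraically closed in `ℂ(t)`: a finite intermediate field of `ℂ(t)/ℂ` is `ℂ`. -/
theorem intermediateField_ratFunc_eq_bot (K : IntermediateField ℂ (RatFunc ℂ))
    [FiniteDimensional ℂ K] : K = ⊥ := by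
  refine le_bot_iff.mp fun x hx => ?_
  obtain ⟨c, hc⟩ := (IsAlgClosed.algebraMap_bijective_of_isIntegral (k := ℂ) (K := K)).2 ⟨x, hx⟩
  have hx' : x = algebraMap ℂ (RatFunc ℂ) c := by
    have := congrArg Subtype.val hc
    simpa using this.symm
  rw [hx']
  exact (⊥ : IntermediateField ℂ (RatFunc ℂ)).algebraMap_mem c

/-- `dim_ℂ ℂ(t) ≥ 7` (indeed infinite): `1, X, …, X⁶` are linearly independent. -/
theorem seven_le_rank_ratFunc : (7 : Cardinal) ≤ Module.rank ℂ (RatFunc ℂ) := by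
  have htr : Transcendental ℂ (RatFunc.X : RatFunc ℂ) :=
    transcendental_of_forall_ne algebraMap_ne_ratFunc_X
  have h := linearIndependent_mul_pow htr (one_ne_zero (α := RatFunc ℂ)) 7
  simpa using h.cardinal_le_rank

/-- **`TwoByTwoHostingEight`** (route FieldSumsetRank, item stmt-MatrixMultiplication-8741): every
polynomial hosting `(α, β, γ)` of `2 × 2` matrix multiplication has cost
`dim(range α · range β) ≥ 8`. -/
theorem twoByTwoHostingEight_proof :
    Summit.MatrixMultiplication.MatrixMultiplication.Theses.FieldSumsetRank.TwoByTwoHostingEight := by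
  intro α β γ hhost
  by_contra hlt
  rw [not_le] at hlt
  set V₁ := LinearMap.range α with hV₁
  set V₂ := LinearMap.range β with hV₂
  haveI hWfd : FiniteDimensional ℂ ↥(V₁ * V₂) :=
    Module.Finite.iff_fg.mpr ((Module.Finite.iff_fg.mp inferInstance).mul
      (Module.Finite.iff_fg.mp inferInstance))
  -- `α`, `β` are injective
  have hαinj : Function.Injective α := fun X X' h => by
    have h1 := hhost X 1
    have h2 := hhost X' 1
    rw [h] at h1
    rw [mul_one] at h1 h2
    exact h1.symm.trans h2
  have hβinj : Function.Injective β := fun Y Y' h => by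
    have h1 := hhost 1 Y
    have h2 := hhost 1 Y'
    rw [h] at h1
    rw [one_mul] at h1 h2
    exact h1.symm.trans h2
  have hM4 : finrank ℂ (Matrix (Fin 2) (Fin 2) ℂ) = 4 := by
    rw [Module.finrank_matrix]
    simp
  have hV₁4 : finrank ℂ V₁ = 4 := by rw [hV₁, LinearMap.finrank_range_of_inj hαinj, hM4]
  have hV₂4 : finrank ℂ V₂ = 4 := by rw [hV₂, LinearMap.finrank_range_of_inj hβinj, hM4]
  -- the products over `XY = 0` span at most `3` dimensions
  set K₀ : Submodule ℂ ℂ[X] := Submodule.span ℂ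
    {z | ∃ X Y : Matrix (Fin 2) (Fin 2) ℂ, X * Y = 0 ∧ z = α X * β Y} with hK₀
  set γW : ↥(V₁ * V₂) →ₗ[ℂ] Matrix (Fin 2) (Fin 2) ℂ := γ ∘ₗ (V₁ * V₂).subtype with hγW
  have hγWtop : LinearMap.range γW = ⊤ := by
    rw [LinearMap.range_eq_top]
    intro Z
    refine ⟨⟨α Z * β 1, Submodule.mul_mem_mul ⟨Z, rfl⟩ ⟨1, rfl⟩⟩, ?_⟩
    simp [hγW, hhost]
  have hker : finrank ℂ (LinearMap.ker γW) ≤ 3 := by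
    have h := LinearMap.finrank_range_add_finrank_ker γW
    rw [hγWtop, finrank_top, hM4] at h
    omega
  have hK₀le : K₀ ≤ (LinearMap.ker γW).map (V₁ * V₂).subtype := by
    rw [hK₀, Submodule.span_le]
    rintro _ ⟨X, Y, hXY, rfl⟩
    have hmem : α X * β Y ∈ V₁ * V₂ := Submodule.mul_mem_mul ⟨X, rfl⟩ ⟨Y, rfl⟩
    refine ⟨⟨α X * β Y, hmem⟩, ?_, rfl⟩
    rw [SetLike.mem_coe, LinearMap.mem_ker, hγW, LinearMap.comp_apply, Submodule.subtype_apply,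
      hhost, hXY]
  haveI : FiniteDimensional ℂ K₀ := Submodule.finiteDimensional_of_le hK₀le
  have hK₀3 : finrank ℂ K₀ ≤ 3 :=
    (Submodule.finrank_mono hK₀le).trans ((Submodule.finrank_map_subtype_eq _ _).le.trans hker)
  -- transfer to `ℂ(t)`
  set ι : ℂ[X] →ₐ[ℂ] RatFunc ℂ := IsScalarTower.toAlgHom ℂ ℂ[X] (RatFunc ℂ) with hι_def
  have hι : Function.Injective ι := by
    rw [hι_def, IsScalarTower.coe_toAlgHom']
    exact RatFunc.algebraMap_injective ℂ
  have hιl : Function.Injective ι.toLinearMap := hι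
  set S := V₁.map ι.toLinearMap with hS_def
  set T := V₂.map ι.toLinearMap with hT_def
  have hS4 : finrank ℂ S = 4 := by
    rw [hS_def, ← hV₁4]
    exact (LinearEquiv.finrank_eq (Submodule.equivMapOfInjective _ hιl V₁)).symm
  have hT4 : finrank ℂ T = 4 := by
    rw [hT_def, ← hV₂4]
    exact (LinearEquiv.finrank_eq (Submodule.equivMapOfInjective _ hιl V₂)).symm
  have hST : S * T = (V₁ * V₂).map ι.toLinearMap := by
    rw [hS_def, hT_def, ← Submodule.map_mul]
  haveI : FiniteDimensional ℂ ↥(S * T) := finiteDimensional_mul S T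
  have hSTfin : finrank ℂ ↥(S * T) = finrank ℂ ↥(V₁ * V₂) := by
    rw [hST]
    exact (LinearEquiv.finrank_eq (Submodule.equivMapOfInjective _ hιl _)).symm
  have hSne : S ≠ ⊥ := by
    rw [Ne, ← Submodule.finrank_eq_zero, hS4]
    omega
  have hTne : T ≠ ⊥ := by
    rw [Ne, ← Submodule.finrank_eq_zero, hT4]
    omega
  -- linear Cauchy–Davenport: `dim(ST) ≥ 7`
  have h7 : 7 ≤ finrank ℂ ↥(S * T) := by
    have hCD := LinearCauchyDavenport_holds ℂ (RatFunc ℂ)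
      (fun K hK => Or.inl (by haveI := hK; exact intermediateField_ratFunc_eq_bot K))
      S T inferInstance inferInstance hSne hTne
    rw [hS4, hT4, min_eq_right (by norm_num; exact seven_le_rank_ratFunc),
      ← Module.finrank_eq_rank] at hCD
    exact_mod_cast hCD
  have hST7 : finrank ℂ ↥(S * T) = finrank ℂ S + finrank ℂ T - 1 := by
    rw [hS4, hT4]
    omega
  -- linear Vosper: dilated progressions
  have hbt : (⊥ : Subalgebra ℂ (RatFunc ℂ)) ≠ ⊤ := by
    intro h
    have hX : (RatFunc.X : RatFunc ℂ) ∈ (⊥ : Subalgebra ℂ (RatFunc ℂ)) := h ▸ Algebra.mem_top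
    obtain ⟨c, hc⟩ := Algebra.mem_bot.mp hX
    exact algebraMap_ne_ratFunc_X c hc
  obtain ⟨g, g', a, hSspan, hTspan⟩ := LinearVosperAlgClosed_holds ℂ (RatFunc ℂ) hbt S T
    inferInstance inferInstance (by omega) (by omega) hST7
  rw [hS4] at hSspan
  rw [hT4] at hTspan
  have hg : g ≠ 0 := by
    rintro rfl
    apply hSne
    rw [← hSspan, Submodule.span_eq_bot]
    rintro _ ⟨i, rfl⟩
    simp
  have hg' : g' ≠ 0 := by
    rintro rfl
    apply hTne
    rw [← hTspan, Submodule.span_eq_bot]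
    rintro _ ⟨i, rfl⟩
    simp
  have ha : ∀ c : ℂ, algebraMap ℂ (RatFunc ℂ) c ≠ a := by
    intro c hc
    have hle : S ≤ ℂ ∙ g := by
      rw [← hSspan, Submodule.span_le]
      rintro _ ⟨i, rfl⟩
      rw [SetLike.mem_coe, Submodule.mem_span_singleton]
      exact ⟨c ^ (i : ℕ), by rw [Algebra.smul_def, map_pow, hc, mul_comm]⟩
    have h1 := Submodule.finrank_mono hle
    rw [hS4, finrank_span_singleton hg] at h1
    omega
  -- the normalised maps `A = g⁻¹ ι α`, `B = g'⁻¹ ι β`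
  set A : Matrix (Fin 2) (Fin 2) ℂ →ₗ[ℂ] RatFunc ℂ :=
    LinearMap.mulLeft ℂ g⁻¹ ∘ₗ ι.toLinearMap ∘ₗ α with hA_def
  set B : Matrix (Fin 2) (Fin 2) ℂ →ₗ[ℂ] RatFunc ℂ :=
    LinearMap.mulLeft ℂ g'⁻¹ ∘ₗ ι.toLinearMap ∘ₗ β with hB_def
  have hmulinj : ∀ {c : RatFunc ℂ}, c ≠ 0 → Function.Injective (LinearMap.mulLeft ℂ c) :=
    fun hc x y hxy => mul_left_cancel₀ hc hxy
  have hAinj : Function.Injective A := fun x y hxy =>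
    hαinj (hι (hmulinj (inv_ne_zero hg) hxy))
  have hBinj : Function.Injective B := fun x y hxy =>
    hβinj (hι (hmulinj (inv_ne_zero hg') hxy))
  have hrange : ∀ {c : RatFunc ℂ} (hc : c ≠ 0) {δ : Matrix (Fin 2) (Fin 2) ℂ →ₗ[ℂ] ℂ[X]},
      Submodule.span ℂ (Set.range fun i : Fin 4 => c * a ^ (i : ℕ)) =
        (LinearMap.range δ).map ι.toLinearMap →
      LinearMap.range (LinearMap.mulLeft ℂ c⁻¹ ∘ₗ ι.toLinearMap ∘ₗ δ) =
        Submodule.span ℂ (Set.range fun i : Fin 4 => a ^ (i : ℕ)) := by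
    intro c hc δ hspan
    rw [LinearMap.range_comp, LinearMap.range_comp, ← hspan, Submodule.map_span, ← Set.range_comp]
    congr 1
    ext i
    simp [inv_mul_cancel_left₀ hc]
  have hAr : LinearMap.range A = Submodule.span ℂ (Set.range fun i : Fin 4 => a ^ (i : ℕ)) :=
    hrange hg hSspan
  have hBr : LinearMap.range B = Submodule.span ℂ (Set.range fun i : Fin 4 => a ^ (i : ℕ)) :=
    hrange hg' hTspan
  -- the small space of products over `XY = 0`
  set KL : Submodule ℂ (RatFunc ℂ) :=
    (K₀.map ι.toLinearMap).map (LinearMap.mulLeft ℂ (g⁻¹ * g'⁻¹)) with hKL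
  have hKL3 : finrank ℂ KL ≤ 3 := by
    rw [hKL, finrank_dil (mul_ne_zero (inv_ne_zero hg) (inv_ne_zero hg')),
      ← LinearEquiv.finrank_eq (Submodule.equivMapOfInjective _ hιl K₀)]
    exact hK₀3
  have hK : ∀ X Y : Matrix (Fin 2) (Fin 2) ℂ, X * Y = 0 → A X * B Y ∈ KL := by
    intro X Y hXY
    have h1 : A X * B Y = LinearMap.mulLeft ℂ (g⁻¹ * g'⁻¹) (ι.toLinearMap (α X * β Y)) := by
      simp only [hA_def, hB_def, LinearMap.comp_apply, LinearMap.mulLeft_apply,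
        AlgHom.toLinearMap_apply, map_mul]
      ring
    rw [h1, hKL]
    refine Submodule.mem_map_of_mem (Submodule.mem_map_of_mem ?_)
    rw [hK₀]
    exact Submodule.subset_span ⟨X, Y, hXY, rfl⟩
  exact rigidity ha A B hAinj hBinj hAr hBr.le KL hKL3 hK

end TwoByTwoHosting

end Summit.MatrixMultiplication.MatrixMultiplication.Theorems
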